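import Mathlib
import HarnessLib
import Summits.HubbardSuperconductivity.HubbardSuperconductivity.Theorems.WeakCouplingBCSKlThirdOrderSlot
import Summits.HubbardSuperconductivity.HubbardSuperconductivity.Theorems.WeakCouplingBCSDefsKlThirdOrderChains

/-!
# WeakCouplingBCS — KL certificate: the explicit-`U₀` slot THROUGH THIRD ORDER WITH THE BUBBLE/LADDER CHAINS RESUMMED (statements first, kit-free)

Twin of `…KlThirdOrderSlot` (✓ p732729) for the lane's second purpose clause («ladder-resummed higher-order KL-kernel contributions»):
the concrete `Λ` is now the channel bottom of the pp-irreducible vertex with the two-loop third-order diagrams AND both chain families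
(crossed ladder `Σ_{n≥2} Uⁿ χ₀(k+k')ⁿ⁻¹`, longitudinal bubble chain `Σ_{m≥1} U^{2m+1} χ₀(k−k')^{2m}`; Scalapino–Loh–Hirsch 1986) summed to
all orders — the tree's `KlThirdOrder.klResummedKernel ε μ U` / `resummedForm` (`…DefsKlThirdOrderChains`):

* §1 `klLambdaRes tp χ μ U = inf_ψ (pairingForm ε_{t′} μ U ψ + U³ ⟨ψ, K_res(U) ψ⟩)` over the normalised channel states, the channel bottom
  `KlThirdOrder.channelInfRes ε μ U χ = inf_ψ resummedForm ε μ U ψ`, and ONE hypothesis kind (a slot; asserts nothing)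
  `KlThirdOrder.ResummedFormBound tp a b M U₁ := ∀ μ ∈ [a, b], ∀ U ∈ (0, U₁], ∀ χ ψ, IsChannelState ε_{t′} μ χ ψ → |⟨ψ, K_res(U) ψ⟩_{σ_μ}| ≤ M`
  (`U₁` = the range on which the chain envelopes are certified; the lane's tables use `U₁ = 1/16`).
* §2 `klChannelRemainderBound_lambdaRes : 0 ≤ M → ResummedFormBound tp a b M U₁ → KLChannelRemainderBound tp a b (klLambdaRes tp) M U₁`
  (the inf-perturbation lemma `kl_abs_sInf_image_add_sub_le` of the twin file).
* §3 identification at `t′ = 0`, `μ ∈ (−4, 0)`, `0 < U`: `klLambdaRes 0 χ μ U = U² · channelInfRes ε₀ μ U χ`.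
* §4 selection with the chains resummed below `klU0 γ M U₁ = min(1, U₁, γ/2M)`: generic from `KLB1gDominatesTP 0 a b γ`, from any accepted
  `t′ = 0` record, on the doping window `δ ∈ [0.10, 0.20]` (`μ ∈ [−0.42749, −0.1775]`, ✓ `klb1g_window_d010_d020`, `γ = 437/16384`) and by
  name for `klCertB1gWin{A,B,C}`: **`channelInfRes ε₀ μ U B1g < channelInfRes ε₀ μ U χ`** for `0 < U < klU0 γ M U₁`, `χ ≠ B1g` — modulo the
  records' `EnclosuresB1g` and `ResummedFormBound 0 a b M U₁`.

Honest framing: still a TRUNCATION (third-order two-loop diagrams + all chain orders; the non-chain diagrams of order `≥ 4` are NOT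
included — they are the abstract `R`/`C` of `klLambdaR` in the twin file); `M`, `U₁` are hypotheses; no literal is typed here; register
expectation 0.00; RECORD ≠ DECIDED; nothing about convergence of the Bochner integrals, the window beyond the records, or superconductivity;
a Kohn–Luttinger channel statement is not ODLRO and nothing here proves superconductivity in the Hubbard model.
Filed `--supports stmt-HubbardSuperconductivity-0158`.

References: D. J. Scalapino, E. Loh, J. E. Hirsch, Phys. Rev. B 34 (1986) 8190, (3)–(4); S. Raghu, S. A. Kivelson, D. J. Scalapino,
Phys. Rev. B 81 (2010) 224505, §IV–V, App. A; W. Kohn, J. M. Luttinger, Phys. Rev. Lett. 15 (1965) 524.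
-/

noncomputable section

-- the tree's namespace `Summit.<Summit>.<Problem>.Theorems` repeats the summit name by design (D-0017)
set_option linter.dupNamespace false

namespace Summit.HubbardSuperconductivity.HubbardSuperconductivity.Theorems

open MeasureTheory Literature.MathematicalPhysics.QuantumLattice CwKLChiralWindow KlThirdOrder
open scoped Pointwise

/-! ### §1 The objects and the hypothesis kind -/

/-- **Chain-resummed channel bottom in pairing units** for the `t`–`t′` band:
`Λ_res(χ; μ, U) = inf_ψ (⟨ψ, Γ^{(2)}_U ψ⟩ + U³ ⟨ψ, K_res(U) ψ⟩)` over the normalised channel states (`K_res(U) = klResummedKernel ε μ U` =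
resummed chains per `U³` + `T_V + T_P`).  At `t′ = 0` this is `U² · channelInfRes ε₀ μ U χ` (`klLambdaRes_zero_eq`).
[cite: ScalapinoLohHirsch1986, (3)-(4)] -/
def klLambdaRes (tp : ℝ) (χ : D4Irrep) (μ U : ℝ) : ℝ :=
  sInf ((fun ψ => pairingForm (squareDispersion 1 tp) μ U ψ +
      U ^ 3 * kform (fermiCurveMeasure (squareDispersion 1 tp) μ) (klResummedKernel (squareDispersion 1 tp) μ U) ψ) ''
    {ψ | IsChannelState (squareDispersion 1 tp) μ χ ψ})

/-- **Chain-resummed channel bottom** `inf_ψ resummedForm ε μ U ψ` over the normalised channel states of `χ` (the `Γ_U/U²` form through third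
order with both chain families resummed; `sInf` in `ℝ`). [cite: ScalapinoLohHirsch1986, (3)-(4)] -/
def KlThirdOrder.channelInfRes (ε : Momentum → ℝ) (μ U : ℝ) (χ : D4Irrep) : ℝ :=
  sInf (resummedForm ε μ U '' {ψ | IsChannelState ε μ χ ψ})

/-- **Two-sided resummed enclosure — HYPOTHESIS KIND** (a slot; asserts nothing): on `μ ∈ [a, b]` and `0 < U ≤ U₁`, the resummed kernel
form is bounded by `M` in absolute value on every normalised channel state: `|⟨ψ, K_res(U) ψ⟩_{σ_μ}| ≤ M`.  (The lane's U0-TABLE allowances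
`h3 + U₁·h4e + t_B` (even `ψ`) / `U₁·h4o` + two-loop odd bound (odd `ψ`) are such numbers, with `U₁ = 1/16`.) [folklore] -/
def KlThirdOrder.ResummedFormBound (tp a b M U₁ : ℝ) : Prop :=
  ∀ μ ∈ Set.Icc a b, ∀ U ∈ Set.Ioc (0 : ℝ) U₁, ∀ (χ : D4Irrep) (ψ : Momentum → ℝ), IsChannelState (squareDispersion 1 tp) μ χ ψ →
    |kform (fermiCurveMeasure (squareDispersion 1 tp) μ) (klResummedKernel (squareDispersion 1 tp) μ U) ψ| ≤ M

/-! ### §2 The slot's remainder hypothesis holds for `Λ_res` -/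

/-- **`KLChannelRemainderBound` with the chains resummed.** `ResummedFormBound tp a b M U₁` with `0 ≤ M` gives
`|Λ_res(χ; μ, U) − channelInf ε_{t′} μ U χ| ≤ M·U³` for `μ ∈ [a, b]`, `0 < U ≤ U₁`, every channel.
[cite: ScalapinoLohHirsch1986, (3)-(4)] -/
theorem klChannelRemainderBound_lambdaRes {tp a b M U₁ : ℝ} (hM : 0 ≤ M) (hF : KlThirdOrder.ResummedFormBound tp a b M U₁) :
    KLChannelRemainderBound tp a b (klLambdaRes tp) M U₁ := by
  intro μ hμ U hU χ
  have hU3 : 0 ≤ U ^ 3 := pow_nonneg hU.1.le 3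
  have key := kl_abs_sInf_image_add_sub_le
    (S := {ψ | IsChannelState (squareDispersion 1 tp) μ χ ψ})
    (f := pairingForm (squareDispersion 1 tp) μ U)
    (g := fun ψ => U ^ 3 * kform (fermiCurveMeasure (squareDispersion 1 tp) μ)
      (klResummedKernel (squareDispersion 1 tp) μ U) ψ)
    (M := M * U ^ 3) (fun ψ hψ => by
      rw [abs_mul, abs_of_nonneg hU3, mul_comm]
      exact mul_le_mul_of_nonneg_right (hF μ hμ U hU χ ψ hψ) hU3) (mul_nonneg hM hU3)
  simpa [klLambdaRes, channelInf] using key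

/-! ### §3 Identification with `channelInfRes` at `t′ = 0` -/

/-- For `ε₀`, `μ ∈ (−4, 0)`, `U ≠ 0`, `ψ ∈ L²(σ_μ)`: `pairingForm ε₀ μ U ψ + U³⟨ψ, K_res(U) ψ⟩ = U² · resummedForm ε₀ μ U ψ`. [folklore] -/
theorem kl_pairingForm_add_cube_eq_sq_mul_resummedForm {μ : ℝ} (hμ : μ ∈ Set.Ioo (-4 : ℝ) 0) {U : ℝ} (hU : U ≠ 0)
    {ψ : Momentum → ℝ} (hψ : MemLp ψ 2 (fermiCurveMeasure (squareDispersion 1 0) μ)) :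
    pairingForm (squareDispersion 1 0) μ U ψ +
        U ^ 3 * kform (fermiCurveMeasure (squareDispersion 1 0) μ) (klResummedKernel (squareDispersion 1 0) μ U) ψ =
      U ^ 2 * resummedForm (squareDispersion 1 0) μ U ψ := by
  rw [(stub_klFrameHS stub_klKernelHS μ hμ U ψ hψ).1]
  unfold resummedForm kform lindhardKernel
  field_simp

/-- **`Λ_res = U² · channelInfRes` at `t′ = 0`**: for `μ ∈ (−4, 0)` and `0 < U`. [cite: ScalapinoLohHirsch1986, (3)-(4)] -/
theorem klLambdaRes_zero_eq {μ : ℝ} (hμ : μ ∈ Set.Ioo (-4 : ℝ) 0) {U : ℝ} (hU : 0 < U) (χ : D4Irrep) :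
    klLambdaRes 0 χ μ U = U ^ 2 * channelInfRes (squareDispersion 1 0) μ U χ := by
  unfold klLambdaRes channelInfRes
  have himg : (fun ψ => pairingForm (squareDispersion 1 0) μ U ψ +
        U ^ 3 * kform (fermiCurveMeasure (squareDispersion 1 0) μ) (klResummedKernel (squareDispersion 1 0) μ U) ψ) ''
        {ψ | IsChannelState (squareDispersion 1 0) μ χ ψ} =
      (U ^ 2) • ((resummedForm (squareDispersion 1 0) μ U) '' {ψ | IsChannelState (squareDispersion 1 0) μ χ ψ}) := by
    rw [← Set.image_smul, Set.image_image]
    refine Set.image_congr fun ψ hψ => ?_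
    rw [smul_eq_mul]
    exact kl_pairingForm_add_cube_eq_sq_mul_resummedForm hμ hU.ne' hψ.1
  rw [himg, Real.sInf_smul_of_nonneg (sq_nonneg U), smul_eq_mul]

/-! ### §4 Selection with the chains resummed below the explicit `U₀` -/

/-- **Resummed `B1g` selection from a second-order margin (generic, `t′ = 0`).** `KLB1gDominatesTP 0 a b γ` with `(a, b) ⊆ (−4, 0)`,
`0 < γ`, `0 ≤ M` and `ResummedFormBound 0 a b M U₁`: for `μ ∈ [a, b]`, `0 < U < klU0 γ M U₁ = min(1, U₁, γ/2M)`, `χ ≠ B1g`,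
`channelInfRes ε₀ μ U B1g < channelInfRes ε₀ μ U χ`. [cite: ScalapinoLohHirsch1986, (3)-(4)] -/
theorem klChannelInfRes_B1g_lt_of_dominates {a b γ M U₁ : ℝ} (hD : KLB1gDominatesTP 0 a b γ) (ha : -4 < a) (hb : b < 0)
    (hγ : 0 < γ) (hM : 0 ≤ M) (hF : KlThirdOrder.ResummedFormBound 0 a b M U₁)
    {μ : ℝ} (hμ : μ ∈ Set.Icc a b) {U : ℝ} (hU0 : 0 < U) (hU : U < klU0 γ M U₁) {χ : D4Irrep} (hχ : χ ≠ D4Irrep.B1g) :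
    channelInfRes (squareDispersion 1 0) μ U D4Irrep.B1g < channelInfRes (squareDispersion 1 0) μ U χ := by
  have hμ' : μ ∈ Set.Ioo (-4 : ℝ) 0 := ⟨lt_of_lt_of_le ha hμ.1, lt_of_le_of_lt hμ.2 hb⟩
  have h := klB1g_full_lt_of_lt_klU0 hD (klChannelRemainderBound_lambdaRes hM hF) hM hγ hμ hU0 hU hχ
  rw [klLambdaRes_zero_eq hμ' hU0, klLambdaRes_zero_eq hμ' hU0] at h
  exact lt_of_mul_lt_mul_left h (sq_nonneg U)

/-- **Resummed `B1g` selection from an accepted `t′ = 0` record** `c` (modulo `hE`), given `ResummedFormBound` on its window with `0 ≤ M`: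
for `μ ∈ [c.mub, c.mua]`, `0 < U < klU0 c.gamma M U₁`, `χ ≠ B1g`, `channelInfRes ε₀ μ U B1g < channelInfRes ε₀ μ U χ`.
[cite: ScalapinoLohHirsch1986, (3)-(4)] -/
theorem klChannelInfRes_B1g_lt_of_checkB1gD (c : KLCert) (hc : c.checkB1gD = true) (hE : c.EnclosuresB1g)
    {M U₁ : ℝ} (hM : 0 ≤ M) (hF : KlThirdOrder.ResummedFormBound 0 ((c.mub : ℚ) : ℝ) ((c.mua : ℚ) : ℝ) M U₁)
    {μ : ℝ} (hμ : μ ∈ Set.Icc ((c.mub : ℚ) : ℝ) ((c.mua : ℚ) : ℝ)) {U : ℝ} (hU0 : 0 < U)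
    (hU : U < klU0 ((c.gamma : ℚ) : ℝ) M U₁) {χ : D4Irrep} (hχ : χ ≠ D4Irrep.B1g) :
    channelInfRes (squareDispersion 1 0) μ U D4Irrep.B1g < channelInfRes (squareDispersion 1 0) μ U χ := by
  obtain ⟨⟨h4, -, h0, hγ⟩, -, -⟩ := klb1gd_coverLogic c hc
  exact klChannelInfRes_B1g_lt_of_dominates (klb1gd_window_U c hc hE) (by exact_mod_cast h4) (by exact_mod_cast h0)
    (by exact_mod_cast hγ) hM hF hμ hU0 hU hχ

/-- **Resummed `B1g` selection on the doping window `δ ∈ [0.10, 0.20]`** (`μ ∈ [−0.42749, −0.1775]`, records `klCertB1gWin{A,B,C}` modulo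
their certified enclosures, `γ = 437/16384`), given `ResummedFormBound 0 (−0.42749) (−0.1775) M U₁` with `0 ≤ M`: for every such `μ`, every
`0 < U < klU0 (437/16384) M U₁` and every `χ ≠ B1g`, **`channelInfRes ε₀ μ U B1g < channelInfRes ε₀ μ U χ`** — the `d_{x²−y²}` channel has
the strictly lowest bottom of the pp-irreducible vertex through third order with the bubble/ladder chains resummed to all orders.
[cite: ScalapinoLohHirsch1986, (3)-(4)] -/
theorem klChannelInfRes_B1g_lt_window_d010_d020 (hA : klCertB1gWinA.EnclosuresB1g) (hB : klCertB1gWinB.EnclosuresB1g)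
    (hC : klCertB1gWinC.EnclosuresB1g) {M U₁ : ℝ} (hM : 0 ≤ M)
    (hF : KlThirdOrder.ResummedFormBound 0 (-0.42749) (-0.1775) M U₁)
    {μ : ℝ} (hμ : μ ∈ Set.Icc (-0.42749 : ℝ) (-0.1775)) {U : ℝ} (hU0 : 0 < U) (hU : U < klU0 (437 / 16384) M U₁)
    {χ : D4Irrep} (hχ : χ ≠ D4Irrep.B1g) :
    channelInfRes (squareDispersion 1 0) μ U D4Irrep.B1g < channelInfRes (squareDispersion 1 0) μ U χ := by
  have hD : KLB1gDominatesTP 0 (-0.42749) (-0.1775)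
      (min (min ((klCertB1gWinA.gamma : ℚ) : ℝ) ((klCertB1gWinB.gamma : ℚ) : ℝ)) ((klCertB1gWinC.gamma : ℚ) : ℝ)) :=
    klb1g_window_d010_d020 hA hB hC
  rw [klb1g_window_d010_d020_gamma_eq] at hD
  exact klChannelInfRes_B1g_lt_of_dominates hD (by norm_num) (by norm_num) (by norm_num) hM hF hμ hU0 hU hχ

/-- **Record `klCertB1gWinA`**: resummed `B1g` selection for `0 < U < klU0 γ_A M U₁`, modulo `EnclosuresB1g` and `ResummedFormBound 0 mub mua M U₁`.
[cite: ScalapinoLohHirsch1986, (3)-(4)] -/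
theorem klChannelInfRes_B1g_lt_WinA (hE : klCertB1gWinA.EnclosuresB1g) {M U₁ : ℝ} (hM : 0 ≤ M)
    (hF : KlThirdOrder.ResummedFormBound 0 ((klCertB1gWinA.mub : ℚ) : ℝ) ((klCertB1gWinA.mua : ℚ) : ℝ) M U₁)
    {μ : ℝ} (hμ : μ ∈ Set.Icc ((klCertB1gWinA.mub : ℚ) : ℝ) ((klCertB1gWinA.mua : ℚ) : ℝ)) {U : ℝ} (hU0 : 0 < U)
    (hU : U < klU0 ((klCertB1gWinA.gamma : ℚ) : ℝ) M U₁) {χ : D4Irrep} (hχ : χ ≠ D4Irrep.B1g) :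
    channelInfRes (squareDispersion 1 0) μ U D4Irrep.B1g < channelInfRes (squareDispersion 1 0) μ U χ :=
  klChannelInfRes_B1g_lt_of_checkB1gD klCertB1gWinA klCertB1gWinA_check hE hM hF hμ hU0 hU hχ

/-- **Record `klCertB1gWinB`**: resummed `B1g` selection for `0 < U < klU0 γ_B M U₁`, modulo `EnclosuresB1g` and `ResummedFormBound 0 mub mua M U₁`.
[cite: ScalapinoLohHirsch1986, (3)-(4)] -/
theorem klChannelInfRes_B1g_lt_WinB (hE : klCertB1gWinB.EnclosuresB1g) {M U₁ : ℝ} (hM : 0 ≤ M)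
    (hF : KlThirdOrder.ResummedFormBound 0 ((klCertB1gWinB.mub : ℚ) : ℝ) ((klCertB1gWinB.mua : ℚ) : ℝ) M U₁)
    {μ : ℝ} (hμ : μ ∈ Set.Icc ((klCertB1gWinB.mub : ℚ) : ℝ) ((klCertB1gWinB.mua : ℚ) : ℝ)) {U : ℝ} (hU0 : 0 < U)
    (hU : U < klU0 ((klCertB1gWinB.gamma : ℚ) : ℝ) M U₁) {χ : D4Irrep} (hχ : χ ≠ D4Irrep.B1g) :
    channelInfRes (squareDispersion 1 0) μ U D4Irrep.B1g < channelInfRes (squareDispersion 1 0) μ U χ :=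
  klChannelInfRes_B1g_lt_of_checkB1gD klCertB1gWinB klCertB1gWinB_check hE hM hF hμ hU0 hU hχ

/-- **Record `klCertB1gWinC`**: resummed `B1g` selection for `0 < U < klU0 γ_C M U₁`, modulo `EnclosuresB1g` and `ResummedFormBound 0 mub mua M U₁`.
[cite: ScalapinoLohHirsch1986, (3)-(4)] -/
theorem klChannelInfRes_B1g_lt_WinC (hE : klCertB1gWinC.EnclosuresB1g) {M U₁ : ℝ} (hM : 0 ≤ M)
    (hF : KlThirdOrder.ResummedFormBound 0 ((klCertB1gWinC.mub : ℚ) : ℝ) ((klCertB1gWinC.mua : ℚ) : ℝ) M U₁)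
    {μ : ℝ} (hμ : μ ∈ Set.Icc ((klCertB1gWinC.mub : ℚ) : ℝ) ((klCertB1gWinC.mua : ℚ) : ℝ)) {U : ℝ} (hU0 : 0 < U)
    (hU : U < klU0 ((klCertB1gWinC.gamma : ℚ) : ℝ) M U₁) {χ : D4Irrep} (hχ : χ ≠ D4Irrep.B1g) :
    channelInfRes (squareDispersion 1 0) μ U D4Irrep.B1g < channelInfRes (squareDispersion 1 0) μ U χ :=
  klChannelInfRes_B1g_lt_of_checkB1gD klCertB1gWinC klCertB1gWinC_check hE hM hF hμ hU0 hU hχ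

end Summit.HubbardSuperconductivity.HubbardSuperconductivity.Theorems

end
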